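import Literature.Topology.FourManifolds.TrisectionFunctorGKStabilizationSplit
import Literature.Topology.FourManifolds.SurfaceGroupLiftableSlides
import Literature.Topology.FourManifolds.SurfaceGroupEpimorphismsProofs
import HarnessLib

/-!
# Nielsen's lifting theorem reduces to the twist group of a handlebody

Topic `Literature/Topology/FourManifolds`; theorems over the named fact
`nielsen_surfaceGroup_mulEquiv_lift` (`TrisectionFunctorGKStabilizationSplit.lean`; Nielsen
1927: every automorphism `α` of `S_g = ⟨a₀, …, b_{g-1} ∣ ∏ᵢ [aᵢ, bᵢ]⟩` is *liftable* — induced by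
an automorphism of the free group `F⟨a₀, …, b_{g-1}⟩` sending the relator to a conjugate of
`r_g^{±1}`), the liftability of the explicit handle moves (`SurfaceGroupLiftableMoves.lean`,
`SurfaceGroupLiftableSlides.lean`) and Zieschang's cancellation engine as used in the tree's proof
of the Grigorchuk–Kurchanov classification of epimorphisms `S_g ↠ F_g`
(`SurfaceGroupEpimorphismsProofs.lean`, `SurfaceGroupEpimorphismsStandard.lean`).

Let `ν = handlebodyProj g : S_g ↠ F_g` (`aᵢ ↦ 1`, `bᵢ ↦ xᵢ`) be the handlebody projection.  We
re-run the two halves of the Grigorchuk–Kurchanov argument KEEPING TRACK OF LIFTABILITY: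

* `SurfaceGroup.exists_autOfFreeAut_forall_apply_b_eq_one` — Zieschang's theorem with its
  witness: for every `φ : S_g → F_g` there is an automorphism `Φ` of the free group with `Φ(r_g)`
  conjugate to `r_g` such that `φ` kills every `autOfFreeAut Φ (bᵢ)`; hence
  (`exists_liftable_forall_apply_a_eq_one`) a LIFTABLE `γ` with `φ(γ aᵢ) = 1` for all `i`;
* `SurfaceGroup.exists_liftable_handlebodyProj_apply` — every automorphism `θ` of `F_g` lifts
  along `ν` to a LIFTABLE automorphism of `S_g` (Griffiths 1964; the lifts of Nielsen's generators
  are the inversion move and the handle slides, liftable by the two files above);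
* `SurfaceGroup.exists_liftable_comp_eq_handlebodyProj` — an epimorphism `S_g ↠ F_g` killing the
  `aᵢ` is `ν ∘ δ⁻¹` with `δ` liftable;
* `SurfaceGroup.exists_twist_liftable_iff` — **the reduction**: for every automorphism `α` of
  `S_g` there is an automorphism `τ` with `ν ∘ τ = ν` (an element of the TWIST GROUP of the
  handlebody: `τ` acts as the identity on `π₁` of the handlebody `S_g ⧸ ⟪aᵢ⟫ = F_g`; Luft 1978,
  McCullough 1985: geometrically the group generated by Dehn twists about meridian discs) such
  that `α` is liftable iff `τ` is; consequently
  `nielsen_surfaceGroup_mulEquiv_lift_of_twist` — **Nielsen's theorem follows from the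
  liftability of the twist group**, `∀ g τ, ν ∘ τ = ν → τ liftable`, and
  `liftable_of_forall_twist_liftable` (genus by genus).

What is NOT here: the liftability of the twist group itself (the remaining, genuinely
Dehn–Nielsen-hard part of Nielsen's theorem: Zieschang–Vogt–Coldewey §§5.3–5.6 prove it through
homotopic binary products in the planar net); genus `≤ 1` is settled unconditionally in
`SurfaceGroupNielsenGenusOne.lean`.

## References

* J. Nielsen, *Untersuchungen zur Topologie der geschlossenen zweiseitigen Flächen*, Acta Math. 50
  (1927) 189–358. [Nielsen1927]
* H. Zieschang, E. Vogt, H.-D. Coldewey, *Surfaces and Planar Discontinuous Groups*, LNM 835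
  (1980), §5.1, §5.2 (Thm. 5.2.8, Cor. 5.2.13, E 5.4), Thm. 5.6.1. [ZieschangVogtColdewey1980]
* H. B. Griffiths, *Automorphisms of a 3-dimensional handlebody*, Abh. Math. Sem. Univ. Hamburg
  26 (1964) 191–210. [GriffithsHB1964Handlebody]
* E. Luft, *Actions of the homeotopy group of an orientable 3-dimensional handlebody*, Math.
  Ann. 234 (1978) 279–292. [Luft1978]
* D. McCullough, *Twist groups of compact 3-manifolds*, Topology 24 (1985) 461–474. [Mccullough1985]
-/

noncomputable section

namespace Literature.Topology.FourManifolds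

open Literature.GroupTheory.CombinatorialGroupTheory List

namespace SurfaceGroup

variable {g : ℕ}

/-! ## Automorphisms induced by free automorphisms are liftable -/

/-- **`autOfFreeAut Φ d h` is liftable** (by `Φ` itself, `ε = 1`, conjugator `d`). [folklore] -/
theorem liftable_autOfFreeAut (Φ : MulAut (FreeGroup (surfaceGen g))) (d : FreeGroup (surfaceGen g))
    (h : Φ (surfaceRelator g) = d * surfaceRelator g * d⁻¹) :
    ∃ (φ : FreeGroup (surfaceGen g) ≃* FreeGroup (surfaceGen g)) (c : FreeGroup (surfaceGen g))
      (ε : ℤ), (ε = 1 ∨ ε = -1) ∧ φ (surfaceRelator g) = c * surfaceRelator g ^ ε * c⁻¹ ∧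
      ∀ x, PresentedGroup.mk _ (φ x) = autOfFreeAut Φ d h (PresentedGroup.mk _ x) :=
  ⟨Φ, d, 1, Or.inl rfl, by rw [zpow_one]; exact h, fun y => (autOfFreeAut_mk Φ d h y).symm⟩

/-! ## Zieschang's theorem with its witness -/

/-- A list is the map of its entries over `finRange`. [folklore] -/
theorem eq_map_finRange_get_cast {α : Type*} (bs : List α) (hlen : bs.length = g) :
    bs = (List.finRange g).map fun i => bs.get (i.cast hlen.symm) := by
  subst hlen
  simp only [Fin.cast_refl, id_eq]
  rw [← List.ofFn_eq_map, List.ofFn_get]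

/-- **Zieschang's theorem, with the inducing free automorphism** (ZVC E 5.4 with Cor. 5.2.13):
for every homomorphism `φ : S_g → F_g` there are an automorphism `Φ` of the free group
`F⟨a₀, …, b_{g-1}⟩` and `d` with `Φ(r_g) = d r_g d⁻¹` such that `φ` kills the image of every `bᵢ`
under the induced automorphism `autOfFreeAut Φ d h` of `S_g`.  (The construction of
`exists_mulEquiv_forall_apply_b_eq_one`, `SurfaceGroupEpimorphismsProofs.lean` — Zieschang's
engine `exists_terminal`, gathering of handles `exists_blocks_of_terminal`, and a signed
relabelling — recording the witness.) [cite: ZieschangVogtColdewey1980, E 5.4, 5.2.13] -/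
theorem exists_autOfFreeAut_forall_apply_b_eq_one (φ : SurfaceGroup g →* FreeGroup (Fin g)) :
    ∃ (Φ : MulAut (FreeGroup (surfaceGen g))) (d : FreeGroup (surfaceGen g))
      (h : Φ (surfaceRelator g) = d * surfaceRelator g * d⁻¹), ∀ i, φ (autOfFreeAut Φ d h (b i)) = 1 := by
  -- adapted from `exists_mulEquiv_forall_apply_b_eq_one` (same construction, witness recorded)
  classical
  set X₀ : surfaceGen g → FreeGroup (Fin g) := fun x => φ (PresentedGroup.of x) with hX₀
  have hX₀rel : FreeGroup.lift X₀ (FreeGroup.mk (surfaceWordStd g)) = 1 := by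
    rw [hX₀, lift_of_comp_mk, mk_surfaceWordStd, mk_surfaceRelator, map_one]
  -- Zieschang's engine: a terminal pattern
  obtain ⟨w, θ, c, hperm, hcert, hZ⟩ :=
    exists_terminal (surfaceWordStd g) (isQuadratic_surfaceWordStd g) X₀ hX₀rel
  have hq : IsQuadratic w := (isQuadratic_surfaceWordStd g).perm hperm.symm
  have hN : Nondeg w :=
    (nondeg_surfaceWordStd g).transport (isQuadratic_surfaceWordStd g).isBalanced θ c hcert
  -- the endgame: gathering handles
  obtain ⟨bs, Θ, c', hpermB, hcertB, hvals⟩ :=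
    exists_blocks_of_terminal (fun i => FreeGroup.lift X₀ (θ (FreeGroup.of i))) hq hN hZ
  -- the blocks enumerate the handles
  have hlen : bs.length = g := by
    have h1 := (hpermB.trans hperm).length_eq
    rw [length_blocksWord, length_surfaceWordStd] at h1
    omega
  set B : Fin g → Block (surfaceGen g) := fun i => bs.get (i.cast hlen.symm) with hB
  have hbs : bs = (List.finRange g).map B := eq_map_finRange_get_cast bs hlen
  have hBmem : ∀ i, B i ∈ bs := fun i => List.get_mem _ _
  have hbw : blocksWord bs = (List.finRange g).flatMap fun i => (B i).word := by
    conv_lhs => rw [hbs]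
    rw [blocksWord, flatMap_map]
  -- the symbols of the blocks are pairwise distinct
  have hnodup : ((List.finRange g).flatMap fun i => (B i).word).Nodup :=
    hbw ▸ (hpermB.trans hperm).nodup_iff.2 (nodup_surfaceWordStd g)
  have hnd : ∀ i, (B i).word.Nodup := fun i => (nodup_flatMap.1 hnodup).1 i (mem_finRange i)
  have hpair : ∀ i j : Fin g, i ≠ j → Disjoint (B i).word (B j).word := by
    intro i j hij
    have hP := (nodup_flatMap.1 hnodup).2
    obtain ⟨l₁, l₂, hl⟩ := append_of_mem (mem_finRange i)
    rw [hl, pairwise_append, pairwise_cons] at hP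
    have hj : j ∈ l₁ ++ i :: l₂ := hl ▸ mem_finRange j
    rcases mem_append.1 hj with hj | hj
    · exact (hP.2.2 j hj i mem_cons_self).symm
    · rcases mem_cons.1 hj with rfl | hj
      · exact absurd rfl hij
      · exact hP.2.1.1 j hj
  let π₀ : surfaceGen g → surfaceGen g := fun x => bif x.2 then (B x.1).z else (B x.1).q
  let ε : surfaceGen g → Bool := fun x => bif x.2 then (B x.1).σ else (B x.1).s
  have hsym : ∀ (x : surfaceGen g) (t : Bool), (π₀ x, t) ∈ (B x.1).word := by
    rintro ⟨i, _ | _⟩ t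
    · rcases Bool.eq_false_or_eq_true t with rfl | rfl <;>
        rcases Bool.eq_false_or_eq_true (B i).s with h | h <;> simp [π₀, Block.word, h]
    · rcases Bool.eq_false_or_eq_true t with rfl | rfl <;>
        rcases Bool.eq_false_or_eq_true (B i).σ with h | h <;> simp [π₀, Block.word, h]
  have hπ₀ : Function.Injective π₀ := by
    rintro ⟨i, t⟩ ⟨j, u⟩ hxy
    change π₀ (i, t) = π₀ (j, u) at hxy
    by_cases hij : i = j
    · subst hij
      by_contra hne
      have htu : t ≠ u := fun h => hne (by rw [h])
      have hqz : (B i).q = (B i).z := by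
        cases t <;> cases u
        · exact absurd rfl htu
        · simpa [π₀] using hxy
        · simpa [π₀] using hxy.symm
        · exact absurd rfl htu
      have h := hnd i
      simp only [Block.word, hqz, nodup_cons, mem_cons, not_mem_nil, or_false, Prod.mk.injEq,
        true_and, not_or] at h
      obtain ⟨⟨h1, -, h3⟩, -⟩ := h
      revert h1 h3
      cases (B i).s <;> cases (B i).σ <;> simp
    · exact (hpair i j hij (hsym (i, t) true) (hxy ▸ hsym (j, u) true)).elim
  let π : surfaceGen g ≃ surfaceGen g := Equiv.ofBijective π₀ (Finite.injective_iff_bijective.1 hπ₀)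
  -- the relabelling carries the relator to the block word
  have hρrel : signedRelabel π ε (surfaceRelator g) = FreeGroup.mk (blocksWord bs) := by
    rw [← mk_surfaceWordStd, signedRelabel_mk, hbw, surfaceWordStd, map_flatMap]
    congr 1
  -- the total automorphism of the free group and the induced automorphism of `S_g`
  let Φ : MulAut (FreeGroup (surfaceGen g)) := θ * Θ * signedRelabel π ε
  have hΦ : Φ (surfaceRelator g) = (θ c' * c) * surfaceRelator g * (θ c' * c)⁻¹ := by
    simp only [Φ, MulAut.mul_apply, hρrel, hcertB, map_mul, map_inv, hcert, mk_surfaceWordStd]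
    group
  refine ⟨Φ, _, hΦ, fun i => ?_⟩
  rw [b_def]
  change φ (autOfFreeAut Φ _ hΦ (PresentedGroup.mk _ (FreeGroup.of (i, true)))) = 1
  rw [autOfFreeAut_mk, ← lift_of_comp_mk]
  change FreeGroup.lift X₀ (θ (Θ (signedRelabel π ε (FreeGroup.of (i, true))))) = 1
  rw [lift_mulAut_apply X₀ θ, signedRelabel_of]
  have hz := hvals _ (hBmem i)
  have hπi : π (i, true) = (B i).z := rfl
  have hεi : ε (i, true) = (B i).σ := rfl
  rw [hπi, hεi]
  cases (B i).σ
  · rw [sgen_false, map_inv, map_inv, hz, inv_one]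
  · rw [sgen_true, hz]

/-- **Every `φ : S_g → F_g` kills `γ(b₀), …, γ(b_{g-1})` for a LIFTABLE automorphism `γ`** of
`S_g` (Zieschang). [cite: ZieschangVogtColdewey1980, E 5.4, 5.2.13] -/
theorem exists_liftable_forall_apply_b_eq_one (φ : SurfaceGroup g →* FreeGroup (Fin g)) :
    ∃ γ : SurfaceGroup g ≃* SurfaceGroup g,
      (∃ (ψ : FreeGroup (surfaceGen g) ≃* FreeGroup (surfaceGen g)) (c : FreeGroup (surfaceGen g))
        (ε : ℤ), (ε = 1 ∨ ε = -1) ∧ ψ (surfaceRelator g) = c * surfaceRelator g ^ ε * c⁻¹ ∧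
        ∀ x, PresentedGroup.mk _ (ψ x) = γ (PresentedGroup.mk _ x)) ∧
      ∀ i, φ (γ (b i)) = 1 := by
  obtain ⟨Φ, d, h, hb⟩ := exists_autOfFreeAut_forall_apply_b_eq_one φ
  exact ⟨autOfFreeAut Φ d h, liftable_autOfFreeAut Φ d h, hb⟩

/-- **Every `φ : S_g → F_g` kills `γ(a₀), …, γ(a_{g-1})` for a LIFTABLE automorphism `γ`** of
`S_g` (a cut swap `aᵢ ↦ aᵢbᵢaᵢ⁻¹`, liftable by `liftable_cutSwapEquiv`, after the previous
theorem). [cite: ZieschangVogtColdewey1980, E 5.4, 5.2.13] -/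
theorem exists_liftable_forall_apply_a_eq_one (φ : SurfaceGroup g →* FreeGroup (Fin g)) :
    ∃ γ : SurfaceGroup g ≃* SurfaceGroup g,
      (∃ (ψ : FreeGroup (surfaceGen g) ≃* FreeGroup (surfaceGen g)) (c : FreeGroup (surfaceGen g))
        (ε : ℤ), (ε = 1 ∨ ε = -1) ∧ ψ (surfaceRelator g) = c * surfaceRelator g ^ ε * c⁻¹ ∧
        ∀ x, PresentedGroup.mk _ (ψ x) = γ (PresentedGroup.mk _ x)) ∧
      ∀ i, φ (γ (a i)) = 1 := by
  obtain ⟨γ, hγ, hb⟩ := exists_liftable_forall_apply_b_eq_one φ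
  refine ⟨(cutSwapEquiv fun _ => true).trans γ, liftable_trans (liftable_cutSwapEquiv _) hγ,
    fun i => ?_⟩
  rw [MulEquiv.trans_apply, cutSwapEquiv_a, if_pos rfl, map_mul, map_mul, map_inv, map_mul, map_mul,
    map_inv, hb i, mul_one, mul_inv_cancel]

/-! ## Every automorphism of `F_g` lifts along `ν` to a liftable automorphism of `S_g` -/

/-- The intertwining `ν ∘ δ = θ ∘ ν` is checked on the generators of `S_g`. [folklore] -/
theorem forall_handlebodyProj_apply_of_forall_of (θ : MulAut (FreeGroup (Fin g)))
    (δ : SurfaceGroup g ≃* SurfaceGroup g)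
    (h : ∀ p : surfaceGen g,
      handlebodyProj g (δ (PresentedGroup.of p)) = θ (handlebodyProjGens g p)) :
    ∀ x, handlebodyProj g (δ x) = θ (handlebodyProj g x) := by
  intro x
  have H : (handlebodyProj g).comp δ.toMonoidHom = θ.toMonoidHom.comp (handlebodyProj g) :=
    PresentedGroup.ext fun p => by simpa [handlebodyProj_of] using h p
  simpa using DFunLike.congr_fun H x

/-- **Nielsen's inversion `xₖ ↦ xₖ⁻¹` lifts along `ν` to the (liftable) inversion move
`flipEquiv k`.** [cite: GriffithsHB1964Handlebody] -/
theorem forall_handlebodyProj_flipEquiv (k : Fin g) (x : SurfaceGroup g) :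
    handlebodyProj g (flipEquiv k x) = nielsenAlpha k (handlebodyProj g x) := by
  -- adapted from `nielsenAlpha_mem_liftable` (`SurfaceGroupEpimorphismsStandard.lean`)
  refine forall_handlebodyProj_apply_of_forall_of _ (flipEquiv k) ?_ x
  rintro ⟨i, _ | _⟩
  · by_cases hi : i = k
    · subst hi
      rw [← a_def, flipEquiv_a_self]
      simp [map_mul, map_inv]
    · rw [← a_def, flipEquiv_a_of_ne hi]
      simp
  · by_cases hi : i = k
    · subst hi
      rw [← b_def, flipEquiv_b_self]
      simp [map_mul, map_inv]
    · rw [← b_def, flipEquiv_b_of_ne hi]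
      simp [nielsenAlpha_of_ne hi]

/-- **Nielsen's transvection `xₖ ↦ xₖ xₗ` (`k < l`) lifts along `ν` to the (liftable) handle slide
`slideEquiv`.** [cite: GriffithsHB1964Handlebody] -/
theorem forall_handlebodyProj_slideEquiv {k l : Fin g} (hkl : k < l) (x : SurfaceGroup g) :
    handlebodyProj g (slideEquiv hkl x) = nielsenBeta k l hkl.ne (handlebodyProj g x) := by
  -- adapted from `nielsenBeta_mem_liftable_of_lt` (`SurfaceGroupEpimorphismsStandard.lean`)
  refine forall_handlebodyProj_apply_of_forall_of _ (slideEquiv hkl) ?_ x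
  rintro ⟨i, s⟩
  rw [slideEquiv_of]
  by_cases hik : i = k
  · subst hik
    cases s
    · rw [blockGens_k_false]
      simp [HandleWords.slideA, map_mul, map_inv]
    · rw [blockGens_k_true]
      simp only [HandleWords.slideB, map_mul, map_inv, handlebodyProj_a, handlebodyProj_b,
        handlebodyProj_mid, handlebodyProjGens_true, nielsenBeta_of_self]
      group
  by_cases hil : i = l
  · subst hil
    cases s
    · rw [blockGens_l_false hkl]
      simp only [HandleWords.slideC, map_mul, map_inv, handlebodyProj_a, handlebodyProj_b,
        handlebodyProj_mid, handlebodyProjGens_false, map_one]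
      group
    · rw [blockGens_l_true hkl]
      simp only [HandleWords.slideD, map_mul, map_inv, handlebodyProj_a, handlebodyProj_b,
        handlebodyProj_mid, handlebodyProjGens_true, nielsenBeta_of_ne hkl.ne hkl.ne']
      group
  · rw [blockGens_of_ne _ _ _ _ hik hil, handlebodyProj_of]
    cases s
    · simp
    · simp [nielsenBeta_of_ne hkl.ne hik]

/-- **Nielsen's transvection `xₗ ↦ xₗ xₖ` (`k < l`) lifts along `ν` to the (liftable) handle slide
`coslideEquiv`.** [cite: GriffithsHB1964Handlebody] -/
theorem forall_handlebodyProj_coslideEquiv {k l : Fin g} (hkl : k < l) (x : SurfaceGroup g) :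
    handlebodyProj g (coslideEquiv hkl x) = nielsenBeta l k hkl.ne' (handlebodyProj g x) := by
  -- adapted from `nielsenBeta_mem_liftable_of_gt` (`SurfaceGroupEpimorphismsStandard.lean`)
  refine forall_handlebodyProj_apply_of_forall_of _ (coslideEquiv hkl) ?_ x
  rintro ⟨i, s⟩
  rw [coslideEquiv_of]
  by_cases hik : i = k
  · subst hik
    cases s
    · rw [blockGens_k_false]
      simp only [HandleWords.coslideA, map_mul, map_inv, handlebodyProj_a, handlebodyProj_b,
        handlebodyProj_mid, handlebodyProjGens_false, map_one]
      group
    · rw [blockGens_k_true]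
      simp only [HandleWords.coslideB, map_mul, map_inv, handlebodyProj_a, handlebodyProj_b,
        handlebodyProj_mid, handlebodyProjGens_true, nielsenBeta_of_ne hkl.ne' hkl.ne]
      group
  by_cases hil : i = l
  · subst hil
    cases s
    · rw [blockGens_l_false hkl]
      simp only [HandleWords.coslideC, map_mul, map_inv, handlebodyProj_a, handlebodyProj_b,
        handlebodyProj_mid, handlebodyProjGens_false, map_one]
      group
    · rw [blockGens_l_true hkl]
      simp only [HandleWords.coslideD, map_mul, map_inv, handlebodyProj_a, handlebodyProj_b,
        handlebodyProj_mid, handlebodyProjGens_true, nielsenBeta_of_self]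
      group
  · rw [blockGens_of_ne _ _ _ _ hik hil, handlebodyProj_of]
    cases s
    · simp
    · simp [nielsenBeta_of_ne hkl.ne' hil]

/-- **Every automorphism `θ` of `F_g` lifts along the handlebody projection to a LIFTABLE
automorphism of `S_g`**: `ν ∘ δ = θ ∘ ν` with `δ` liftable (Griffiths 1964 / Zieschang 1964,
through Nielsen's generators of `Aut F_g`, `closure_elementaryNielsen_fin_eq_top`, lifted to the
inversion move and the handle slides, which are liftable by `liftable_flipEquiv`,
`liftable_slideEquiv`, `liftable_coslideEquiv`). [cite: GriffithsHB1964Handlebody] -/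
theorem exists_liftable_handlebodyProj_apply (θ : MulAut (FreeGroup (Fin g))) :
    ∃ δ : SurfaceGroup g ≃* SurfaceGroup g,
      (∃ (ψ : FreeGroup (surfaceGen g) ≃* FreeGroup (surfaceGen g)) (c : FreeGroup (surfaceGen g))
        (ε : ℤ), (ε = 1 ∨ ε = -1) ∧ ψ (surfaceRelator g) = c * surfaceRelator g ^ ε * c⁻¹ ∧
        ∀ x, PresentedGroup.mk _ (ψ x) = δ (PresentedGroup.mk _ x)) ∧
      ∀ x, handlebodyProj g (δ x) = θ (handlebodyProj g x) := by
  let H : Subgroup (MulAut (FreeGroup (Fin g))) :=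
    { carrier := {θ | ∃ δ : SurfaceGroup g ≃* SurfaceGroup g,
        (∃ (ψ : FreeGroup (surfaceGen g) ≃* FreeGroup (surfaceGen g)) (c : FreeGroup (surfaceGen g))
          (ε : ℤ), (ε = 1 ∨ ε = -1) ∧ ψ (surfaceRelator g) = c * surfaceRelator g ^ ε * c⁻¹ ∧
          ∀ x, PresentedGroup.mk _ (ψ x) = δ (PresentedGroup.mk _ x)) ∧
        ∀ x, handlebodyProj g (δ x) = θ (handlebodyProj g x)}
      one_mem' := ⟨MulEquiv.refl _, liftable_refl g, fun x => by simp⟩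
      mul_mem' := by
        rintro θ₁ θ₂ ⟨δ₁, hδ₁, h₁⟩ ⟨δ₂, hδ₂, h₂⟩
        exact ⟨δ₂.trans δ₁, liftable_trans hδ₂ hδ₁, fun x => by
          rw [MulEquiv.trans_apply, MulAut.mul_apply, h₁, h₂]⟩
      inv_mem' := by
        rintro θ ⟨δ, hδ, h⟩
        refine ⟨δ.symm, liftable_symm hδ, fun x => ?_⟩
        have hx := h (δ.symm x)
        rw [MulEquiv.apply_symm_apply] at hx
        rw [hx, MulAut.inv_apply_self] }
  suffices hH : H = ⊤ by
    have hθ : θ ∈ H := by rw [hH]; exact Subgroup.mem_top θ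
    exact hθ
  rw [eq_top_iff, ← closure_elementaryNielsen_fin_eq_top, Subgroup.closure_le]
  rintro θ (⟨k, rfl⟩ | ⟨k, l, hkl, rfl⟩)
  · exact ⟨flipEquiv k, liftable_flipEquiv k, forall_handlebodyProj_flipEquiv k⟩
  · rcases lt_or_gt_of_ne hkl with h | h
    · exact ⟨slideEquiv h, liftable_slideEquiv h, forall_handlebodyProj_slideEquiv h⟩
    · exact ⟨coslideEquiv h, liftable_coslideEquiv h, forall_handlebodyProj_coslideEquiv h⟩

/-- **An epimorphism `φ : S_g ↠ F_g` killing every `aᵢ` is `ν` up to a LIFTABLE automorphism of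
`S_g`**: `φ ∘ δ = ν` with `δ` liftable.  (As `exists_mulEquiv_comp_eq_handlebodyProj`: `φ = û ∘ ν`
with `u = (φ bᵢ)ᵢ` a generating `g`-tuple of `F_g`, `û ∘ ε = id` for an automorphism `ε` of `F_g`
by the normal form of generating tuples, Lyndon–Schupp I Prop. 2.7, and `ε` lifts to a liftable
`δ`.) [cite: LyndonSchupp2001, Ch. I Prop. 2.7] [cite: GriffithsHB1964Handlebody] -/
theorem exists_liftable_comp_eq_handlebodyProj (φ : SurfaceGroup g →* FreeGroup (Fin g))
    (hφ : Function.Surjective φ) (ha : ∀ i, φ (a i) = 1) :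
    ∃ δ : SurfaceGroup g ≃* SurfaceGroup g,
      (∃ (ψ : FreeGroup (surfaceGen g) ≃* FreeGroup (surfaceGen g)) (c : FreeGroup (surfaceGen g))
        (ε : ℤ), (ε = 1 ∨ ε = -1) ∧ ψ (surfaceRelator g) = c * surfaceRelator g ^ ε * c⁻¹ ∧
        ∀ x, PresentedGroup.mk _ (ψ x) = δ (PresentedGroup.mk _ x)) ∧
      φ.comp δ.toMonoidHom = handlebodyProj g := by
  -- adapted from `exists_mulEquiv_comp_eq_handlebodyProj` (liftable lift of `ε`)
  set u : Fin g → FreeGroup (Fin g) := fun i => φ (b i) with hu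
  have hfac : ∀ y, φ y = FreeGroup.lift u (handlebodyProj g y) := by
    intro y
    have H : φ = (FreeGroup.lift u).comp (handlebodyProj g) := by
      refine PresentedGroup.ext fun p => ?_
      obtain ⟨i, _ | _⟩ := p
      · rw [← a_def]; simp [ha i]
      · rw [← b_def]; simp [hu]
    exact DFunLike.congr_fun H y
  have hgen : Subgroup.closure (Set.range u) = ⊤ := by
    rw [← FreeGroup.range_lift_eq_closure, eq_top_iff]
    rintro x -
    obtain ⟨y, rfl⟩ := hφ x
    exact ⟨handlebodyProj g y, (hfac y).symm⟩
  obtain ⟨ε, hε, -⟩ := exists_mulAut_lift_apply_eq_basis u hgen id Function.injective_id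
  have hid : ∀ y, FreeGroup.lift u (ε y) = y := by
    intro y
    have H : (FreeGroup.lift u).comp ε.toMonoidHom = MonoidHom.id _ :=
      FreeGroup.ext_hom _ _ fun i => by simpa using hε i
    exact DFunLike.congr_fun H y
  obtain ⟨δ, hδl, hδ⟩ := exists_liftable_handlebodyProj_apply (g := g) ε
  refine ⟨δ, hδl, MonoidHom.ext fun y => ?_⟩
  rw [MonoidHom.comp_apply, MulEquiv.coe_toMonoidHom, hfac, hδ, hid]

/-! ## The reduction to the twist group -/

/-- **Every automorphism of `S_g` is a twist up to liftable automorphisms.**  For every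
automorphism `α` of `S_g` there is an automorphism `τ` with `ν ∘ τ = ν` — `τ` lies in the TWIST
GROUP of the handlebody `S_g ⧸ ⟪aᵢ⟫ = F_g = π₁(H_g)` (Luft 1978, McCullough 1985) — such that `α`
is liftable to the free group (in the sense of Nielsen's theorem
`nielsen_surfaceGroup_mulEquiv_lift`) if and only if `τ` is.  Proof: `ν ∘ α` kills `γ(aᵢ)` for a
liftable `γ` (Zieschang), so `ν ∘ α ∘ γ ∘ δ = ν` for a liftable `δ` (Griffiths); take
`τ = α ∘ γ ∘ δ`. [cite: ZieschangVogtColdewey1980, §5.1 and Thm. 5.6.1] [cite: Luft1978]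
[cite: Mccullough1985] -/
theorem exists_twist_liftable_iff (α : SurfaceGroup g ≃* SurfaceGroup g) :
    ∃ τ : SurfaceGroup g ≃* SurfaceGroup g,
      (handlebodyProj g).comp τ.toMonoidHom = handlebodyProj g ∧
      ((∃ (φ : FreeGroup (surfaceGen g) ≃* FreeGroup (surfaceGen g)) (c : FreeGroup (surfaceGen g))
          (ε : ℤ), (ε = 1 ∨ ε = -1) ∧ φ (surfaceRelator g) = c * surfaceRelator g ^ ε * c⁻¹ ∧
          ∀ x, PresentedGroup.mk _ (φ x) = α (PresentedGroup.mk _ x)) ↔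
        (∃ (φ : FreeGroup (surfaceGen g) ≃* FreeGroup (surfaceGen g)) (c : FreeGroup (surfaceGen g))
          (ε : ℤ), (ε = 1 ∨ ε = -1) ∧ φ (surfaceRelator g) = c * surfaceRelator g ^ ε * c⁻¹ ∧
          ∀ x, PresentedGroup.mk _ (φ x) = τ (PresentedGroup.mk _ x))) := by
  -- `ν ∘ α` kills `γ aᵢ` for a liftable `γ`
  obtain ⟨γ, hγ, hγa⟩ :=
    exists_liftable_forall_apply_a_eq_one ((handlebodyProj g).comp α.toMonoidHom)
  -- so `ν ∘ α ∘ γ ∘ δ = ν` for a liftable `δ`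
  obtain ⟨δ, hδ, hδν⟩ := exists_liftable_comp_eq_handlebodyProj
    (((handlebodyProj g).comp α.toMonoidHom).comp γ.toMonoidHom)
    ((handlebodyProj_surjective.comp α.surjective).comp γ.surjective) (fun i => by simpa using hγa i)
  refine ⟨(δ.trans γ).trans α, ?_, ?_⟩
  · refine MonoidHom.ext fun x => ?_
    simpa using DFunLike.congr_fun hδν x
  · have hβ : ∀ y, ((δ.trans γ).symm.trans ((δ.trans γ).trans α)) y = α y := fun y => by
      simp only [MulEquiv.trans_apply, MulEquiv.symm_trans_apply, MulEquiv.apply_symm_apply]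
    constructor
    · intro hα
      exact liftable_trans (liftable_trans hδ hγ) hα
    · intro hτ
      obtain ⟨φ, c, ε, hε, hr, hφ⟩ := liftable_trans (liftable_symm (liftable_trans hδ hγ)) hτ
      exact ⟨φ, c, ε, hε, hr, fun x => (hφ x).trans (hβ _)⟩

/-- **Nielsen's theorem for `S_g` from the liftability of the twist group of genus `g`**: if
every automorphism `τ` of `S_g` with `ν ∘ τ = ν` is liftable to the free group, then every
automorphism of `S_g` is. [cite: ZieschangVogtColdewey1980, Thm. 5.6.1] [cite: Luft1978] -/
theorem liftable_of_forall_twist_liftable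
    (H : ∀ τ : SurfaceGroup g ≃* SurfaceGroup g,
      (handlebodyProj g).comp τ.toMonoidHom = handlebodyProj g →
      ∃ (φ : FreeGroup (surfaceGen g) ≃* FreeGroup (surfaceGen g)) (c : FreeGroup (surfaceGen g))
        (ε : ℤ), (ε = 1 ∨ ε = -1) ∧ φ (surfaceRelator g) = c * surfaceRelator g ^ ε * c⁻¹ ∧
        ∀ x, PresentedGroup.mk _ (φ x) = τ (PresentedGroup.mk _ x))
    (α : SurfaceGroup g ≃* SurfaceGroup g) :
    ∃ (φ : FreeGroup (surfaceGen g) ≃* FreeGroup (surfaceGen g)) (c : FreeGroup (surfaceGen g))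
      (ε : ℤ), (ε = 1 ∨ ε = -1) ∧ φ (surfaceRelator g) = c * surfaceRelator g ^ ε * c⁻¹ ∧
      ∀ x, PresentedGroup.mk _ (φ x) = α (PresentedGroup.mk _ x) := by
  obtain ⟨τ, hτν, hiff⟩ := exists_twist_liftable_iff α
  exact hiff.2 (H τ hτν)

end SurfaceGroup

/-- **Nielsen's lifting theorem reduces to the twist groups of handlebodies.**  If for every
genus `g` every automorphism `τ` of `S_g` inducing the identity on `π₁` of the handlebody
(`ν ∘ τ = ν`, `ν = handlebodyProj g : aᵢ ↦ 1, bᵢ ↦ xᵢ`; the twist group, generated geometrically by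
Dehn twists about meridian discs — Luft 1978, McCullough 1985) is induced by an automorphism of the
free group `F⟨a₀, …, b_{g-1}⟩` sending `r_g` to a conjugate of `r_g^{±1}`, then so is EVERY
automorphism of every `S_g`: the named fact `nielsen_surfaceGroup_mulEquiv_lift` (Nielsen 1927;
Zieschang–Vogt–Coldewey Thm. 5.6.1) holds. [cite: ZieschangVogtColdewey1980, Thm. 5.6.1]
[cite: Luft1978] [cite: Mccullough1985] -/
theorem nielsen_surfaceGroup_mulEquiv_lift_of_twist
    (H : ∀ (g : ℕ) (τ : SurfaceGroup g ≃* SurfaceGroup g),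
      (SurfaceGroup.handlebodyProj g).comp τ.toMonoidHom = SurfaceGroup.handlebodyProj g →
      ∃ (φ : FreeGroup (surfaceGen g) ≃* FreeGroup (surfaceGen g)) (c : FreeGroup (surfaceGen g))
        (ε : ℤ), (ε = 1 ∨ ε = -1) ∧ φ (surfaceRelator g) = c * surfaceRelator g ^ ε * c⁻¹ ∧
        ∀ x, PresentedGroup.mk _ (φ x) = τ (PresentedGroup.mk _ x)) :
    nielsen_surfaceGroup_mulEquiv_lift :=
  fun g α => SurfaceGroup.liftable_of_forall_twist_liftable (H g) α

end Literature.Topology.FourManifolds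

end
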